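import Literature.NumberTheory.GaloisRepresentations.LubinTateColemanRelativeLogDerivSurjModTwo
import HarnessLib

/-!
# `q = 2`, relative situation: `δ_E` of the twisted-`𝒩_E`-invariant units is `π`-adically dense in the twisted
# `𝒮_E`-eigenseries (de Shalit I §3.12 Corollary over an unramified base, successive approximation)

De Shalit, *Iwasawa theory of elliptic curves with complex multiplication* (1987), Ch. I §3.12 Corollary:
"`δ(ℳ) mod 𝔭' = 𝓔/p𝓔`, so `δ(ℳ) = 𝓔`".  The tree's `LubinTateColemanLogDerivDense` does the algebraic half of this passage for
`𝒪_F`-coefficients; THIS FILE is the relative, twisted version (`f = πX + X²`, `π = 2u` with `u ∈ 𝒪_F^×` and `π ≡ m₁ (mod π²)` for a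
natural number `m₁` — both automatic for `F = ℚ₂`; `E ⊇ F` finite; `ψ` a ring automorphism of `𝒪_E` over `𝒪_F` with
`ψ(c) ≡ c² (mod π)`):

* ★★ `exists_relNormTwo_eq_map_sub_relLogDeriv_mem_pow` — for every `N ≥ 1` and every `h` with `𝒮_E h = π·h^ψ` there is a
  principal unit `g ∈ 𝒪_E⟦X⟧ˣ` with `𝒩_E g = g^ψ` and **`h ≡ δ_E g (mod π^N)`**.

Step `N → N+1` exactly as in the absolute file: `h − δ_E G = π^N h_N` with `h_N` again a twisted eigenseries
(`exists_eq_C_pow_mul_of_relTraceTwo_eq`), `h_N ≡ δ_E g_N (mod π)` (`LubinTateColemanRelativeLogDerivSurjModTwo`),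
`π^N ≡ m₁^N (mod π^{N+1})`, `G' = G · g_N^{m₁^N}` and `δ_E(g^m) = m·δ_E g`.  Everything PROVED (0 sorry).

## References

* E. de Shalit, *Iwasawa theory of elliptic curves with complex multiplication* (1987), Ch. I §3.12 Corollary. [deShalit1987]
-/

noncomputable section

open scoped PowerSeries.WithPiTopology

namespace Literature.NumberTheory.GaloisRepresentations

/-- `ϖ² ∣ ϖ − m ⟹ ϖ^{N+1} ∣ ϖ^N − m^N` (`N ≥ 1`). [folklore] -/
private theorem pow_succ_dvd_pow_sub_pow₂ {R : Type*} [CommRing R] {ϖ m : R} (h : ϖ ^ 2 ∣ ϖ - m) (N : ℕ) (hN : 1 ≤ N) :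
    ϖ ^ (N + 1) ∣ ϖ ^ N - m ^ N := by
  have hm : ϖ ∣ m := by
    obtain ⟨c, hc⟩ := h
    exact ⟨1 - ϖ * c, by linear_combination -hc⟩
  induction N, hN using Nat.le_induction with
  | base => simpa using h
  | succ N hN ih =>
    have e : ϖ ^ (N + 1) - m ^ (N + 1) = ϖ * (ϖ ^ N - m ^ N) + (ϖ - m) * m ^ N := by ring
    rw [e, pow_succ']
    refine dvd_add (mul_dvd_mul (dvd_refl ϖ) ih) ?_
    have h2 : ϖ ^ 2 * ϖ ^ N ∣ (ϖ - m) * m ^ N := mul_dvd_mul h (pow_dvd_pow_of_dvd hm N)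
    have e2 : ϖ * ϖ ^ (N + 1) = ϖ ^ 2 * ϖ ^ N := by ring
    rw [e2]
    exact h2

/-- `a ∈ (s)`, `G ∈ coeffIdeal (t)` ⟹ `C a · G ∈ coeffIdeal (s t)`. [folklore] -/
private theorem C_mul_mem_coeffIdeal_span_mul₂ {S : Type*} [CommRing S] {a s t : S} (ha : a ∈ Ideal.span {s})
    {G : PowerSeries S} (hG : G ∈ LubinTate.coeffIdeal (Ideal.span {t})) :
    PowerSeries.C a * G ∈ LubinTate.coeffIdeal (Ideal.span {s * t}) := by
  intro k
  rw [PowerSeries.coeff_C_mul, ← Ideal.span_singleton_mul_span_singleton]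
  exact Ideal.mul_mem_mul ha (hG k)

section RelativeDense

open GaloisRepresentations.IsNonarchimedeanLocalField LubinTate ValuativeRel

variable (F : Type*) [Field F] [ValuativeRel F] [TopologicalSpace F] [IsNonarchimedeanLocalField F]

attribute [local instance] ltNormUniformSpace ltNormIsUniformAddGroup rk1 nF nE fintypeResidueField

variable {F}
variable {π : 𝒪[F]} (hπ : (valuation F).IsUniformizer (π : F))
variable (E : IntermediateField F (AlgebraicClosure F)) [FiniteDimensional F E]

/-- `δ_E(G^m) = m · δ_E G`. [cite: deShalit1987, Ch. I §3.4 Lemma (i)] -/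
theorem relLogDeriv_pow (G : (PowerSeries (unitBall E))ˣ) (m : ℕ) :
    relLogDeriv hπ E (G ^ m) = (m : PowerSeries (unitBall E)) * relLogDeriv hπ E G := by
  induction m with
  | zero => rw [pow_zero, relLogDeriv_one, Nat.cast_zero, zero_mul]
  | succ m ih => rw [pow_succ, relLogDeriv_mul, ih]; push_cast; ring

/-- `f` (read in `𝒪_E⟦X⟧`) fixes constants under substitution: `(C c) ∘ f = C c`. [cite: deShalit1987, Ch. I §1.2] -/
private theorem subst_map_ltSer_C' (c : unitBall E) :
    PowerSeries.subst ((ltSer F π).map (algebraMap (LTCoeff F) (unitBall E))) (PowerSeries.C c) = PowerSeries.C c := by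
  have hs : PowerSeries.HasSubst ((ltSer F π).map (algebraMap (LTCoeff F) (unitBall E))) :=
    PowerSeries.HasSubst.of_constantCoeff_zero' ((isLTSeries_ltSer π).map _).constantCoeff_eq_zero
  rw [← PowerSeries.coe_substAlgHom hs, PowerSeries.C_eq_algebraMap, AlgHom.commutes]

/-- `𝒮_E` is `𝒪_E`-linear: `𝒮_E(C c · h) = C c · 𝒮_E h`. [cite: deShalit1987, Ch. I §3.12] -/
theorem relTraceTwo_C_mul (hq : residueFieldCard F = 2) (c : unitBall E) (h : PowerSeries (unitBall E)) :
    relTraceTwo hπ E hq (PowerSeries.C c * h) = PowerSeries.C c * relTraceTwo hπ E hq h := by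
  rw [mul_comm, ← subst_map_ltSer_C' E c, relTraceTwo_mul_subst, subst_map_ltSer_C', mul_comm]

/-- **Twisted eigenseries divisible by `π^N` are `π^N` times twisted eigenseries** (`𝒮_E` is `𝒪_E`-linear, `ψ(π) = π`, and
`𝒪_E⟦X⟧` has no `π`-torsion). [cite: deShalit1987, Ch. I §3.12 Corollary (proof)] -/
theorem exists_eq_C_pow_mul_of_relTraceTwo_eq (hq : residueFieldCard F = 2) {ψ : unitBall E →+* unitBall E}
    (hψ : ψ (algebraMap 𝒪[F] (unitBall E) π) = algebraMap 𝒪[F] (unitBall E) π) (N : ℕ) (h : PowerSeries (unitBall E))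
    (hh : relTraceTwo hπ E hq h = PowerSeries.C (algebraMap 𝒪[F] (unitBall E) π) * PowerSeries.map ψ h)
    (hN : h ∈ coeffIdeal (Ideal.span {algebraMap 𝒪[F] (unitBall E) π ^ N})) :
    ∃ h' : PowerSeries (unitBall E), h = PowerSeries.C (algebraMap 𝒪[F] (unitBall E) π ^ N) * h' ∧
      relTraceTwo hπ E hq h' = PowerSeries.C (algebraMap 𝒪[F] (unitBall E) π) * PowerSeries.map ψ h' := by
  haveI : IsDomain (unitBall E) := inferInstance
  have hπ0 : algebraMap 𝒪[F] (unitBall E) π ≠ 0 := algebraMap_pi_ne_zero hπ E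
  obtain ⟨h', hh'⟩ := exists_eq_C_mul_of_mem_coeffIdeal_span hN
  refine ⟨h', hh', ?_⟩
  have hψN : ψ (algebraMap 𝒪[F] (unitBall E) π ^ N) = algebraMap 𝒪[F] (unitBall E) π ^ N := by rw [map_pow, hψ]
  have e : PowerSeries.C (algebraMap 𝒪[F] (unitBall E) π ^ N) * relTraceTwo hπ E hq h' =
      PowerSeries.C (algebraMap 𝒪[F] (unitBall E) π ^ N) * (PowerSeries.C (algebraMap 𝒪[F] (unitBall E) π) * PowerSeries.map ψ h') := by
    rw [← relTraceTwo_C_mul hπ E hq, ← hh', hh, hh', map_mul (PowerSeries.map ψ), PowerSeries.map_C, hψN]; ring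
  have hC0 : (PowerSeries.C (algebraMap 𝒪[F] (unitBall E) π ^ N) : PowerSeries (unitBall E)) ≠ 0 := by
    intro h0
    have := congrArg PowerSeries.constantCoeff h0
    rw [PowerSeries.constantCoeff_C, map_zero] at this
    exact pow_ne_zero N hπ0 this
  exact mul_left_cancel₀ hC0 e

set_option maxHeartbeats 800000 in
/-- ★★ **Successive approximation** (de Shalit I §3.12 Corollary — the algebraic half — relative and twisted, `q = 2`): with
`π = 2u` (`u ∈ 𝒪_F^×`), `π ≡ m₁ (mod π²)` for some `m₁ ∈ ℕ` (both automatic for `F = ℚ₂`), and `ψ` a ring automorphism of `𝒪_E`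
over `𝒪_F` with `ψ(c) ≡ c² (mod π)`: for every `N ≥ 1` and every `h` with `𝒮_E h = π·h^ψ` there is a PRINCIPAL unit `g` with
`𝒩_E g = g^ψ` and **`h ≡ δ_E g (mod π^N)`**. [cite: deShalit1987, Ch. I §3.12 Corollary] -/
theorem exists_relNormTwo_eq_map_sub_relLogDeriv_mem_pow (hq : residueFieldCard F = 2) (u : (LTCoeff F)ˣ)
    (hu : LTCoeff.of F π = residueFieldCard F * u) (hm : ∃ m₁ : ℕ, LTCoeff.of F π ^ 2 ∣ LTCoeff.of F π - m₁)
    (ψ : unitBall E ≃+* unitBall E)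
    (hψF : ∀ a : LTCoeff F, ψ (algebraMap (LTCoeff F) (unitBall E) a) = algebraMap (LTCoeff F) (unitBall E) a)
    (hψ2 : ∀ c : unitBall E, ψ c - c ^ 2 ∈ Ideal.span {algebraMap 𝒪[F] (unitBall E) π})
    (N : ℕ) (hN : 1 ≤ N) (h : PowerSeries (unitBall E))
    (hh : relTraceTwo hπ E hq h = PowerSeries.C (algebraMap 𝒪[F] (unitBall E) π) * PowerSeries.map (ψ : unitBall E →+* unitBall E) h) :
    ∃ g : (PowerSeries (unitBall E))ˣ,
      relNormTwo hπ E hq (g : PowerSeries (unitBall E)) = PowerSeries.map (ψ : unitBall E →+* unitBall E) g ∧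
      PowerSeries.constantCoeff (g : PowerSeries (unitBall E)) - 1 ∈ Ideal.span {algebraMap 𝒪[F] (unitBall E) π} ∧
      h - relLogDeriv hπ E g ∈ coeffIdeal (Ideal.span {algebraMap 𝒪[F] (unitBall E) π ^ N}) := by
  obtain ⟨m₁, hm₁⟩ := hm
  have hψa : ∀ a : LTCoeff F, (ψ : unitBall E →+* unitBall E) (algebraMap (LTCoeff F) (unitBall E) a) =
      algebraMap (LTCoeff F) (unitBall E) a := hψF
  have hψ : (ψ : unitBall E →+* unitBall E) (algebraMap 𝒪[F] (unitBall E) π) = algebraMap 𝒪[F] (unitBall E) π :=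
    hψF (LTCoeff.of F π)
  -- the integer congruence `π ≡ m₁ (mod π²)` read in `𝒪_E`
  have hm₁E : algebraMap 𝒪[F] (unitBall E) π ^ 2 ∣ algebraMap 𝒪[F] (unitBall E) π - (m₁ : unitBall E) := by
    have h1 := map_dvd (algebraMap (LTCoeff F) (unitBall E)) hm₁
    rwa [map_pow, map_sub, map_natCast] at h1
  -- principal units: `x − 1 ∈ (π) ↔ x̄ = 1`
  have key : ∀ x : unitBall E, x - 1 ∈ Ideal.span {algebraMap 𝒪[F] (unitBall E) π} ↔
      Ideal.Quotient.mk (Ideal.span {algebraMap 𝒪[F] (unitBall E) π}) x = 1 := fun x => by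
    rw [← map_one (Ideal.Quotient.mk (Ideal.span {algebraMap 𝒪[F] (unitBall E) π})), Ideal.Quotient.eq]
  induction N, hN using Nat.le_induction generalizing h with
  | base =>
    obtain ⟨g, hNg, hg0, hg⟩ := exists_relNormTwo_eq_map_sub_relLogDeriv_mem hπ E hq u hu ψ hψF hψ2 h hh
    exact ⟨g, hNg, hg0, by rwa [pow_one]⟩
  | succ N hN1 ih =>
    obtain ⟨G, hNG, hG0, hG⟩ := ih h hh
    -- `h - δ_E G = π^N · h_N` with `h_N` a twisted eigenseries
    have hE' : relTraceTwo hπ E hq (h - relLogDeriv hπ E G) =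
        PowerSeries.C (algebraMap 𝒪[F] (unitBall E) π) * PowerSeries.map (ψ : unitBall E →+* unitBall E) (h - relLogDeriv hπ E G) := by
      rw [relTraceTwo_sub hπ E hq, hh, relTraceTwo_relLogDeriv_of_relNormTwo_eq_map hπ E hq hψa G hNG,
        map_sub (PowerSeries.map (ψ : unitBall E →+* unitBall E)), mul_sub]
    obtain ⟨hN', hhN', hEN⟩ := exists_eq_C_pow_mul_of_relTraceTwo_eq hπ E hq hψ N _ hE' hG
    -- `h_N ≡ δ_E g_N (mod π)`
    obtain ⟨gN, hNgN, hgN0, hgN⟩ := exists_relNormTwo_eq_map_sub_relLogDeriv_mem hπ E hq u hu ψ hψF hψ2 hN' hEN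
    have hmN := pow_succ_dvd_pow_sub_pow₂ hm₁E N hN1
    refine ⟨G * gN ^ (m₁ ^ N), ?_, ?_, ?_⟩
    · -- twisted `𝒩_E`-invariance is multiplicative
      rw [Units.val_mul, Units.val_pow_eq_pow_val, ← relNormTwoHom_apply, map_mul (relNormTwoHom hπ E hq),
        map_pow (relNormTwoHom hπ E hq), relNormTwoHom_apply, relNormTwoHom_apply, hNG, hNgN,
        map_mul (PowerSeries.map (ψ : unitBall E →+* unitBall E)), map_pow (PowerSeries.map (ψ : unitBall E →+* unitBall E))]
    · -- principal
      rw [key] at hG0 hgN0 ⊢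
      rw [Units.val_mul, Units.val_pow_eq_pow_val, map_mul (PowerSeries.constantCoeff (R := unitBall E)),
        map_pow (PowerSeries.constantCoeff (R := unitBall E)),
        map_mul (Ideal.Quotient.mk (Ideal.span {algebraMap 𝒪[F] (unitBall E) π})),
        map_pow (Ideal.Quotient.mk (Ideal.span {algebraMap 𝒪[F] (unitBall E) π})), hG0, hgN0, one_pow, mul_one]
    · -- the congruence modulo `π^{N+1}`
      have e : h - relLogDeriv hπ E (G * gN ^ (m₁ ^ N)) =
          PowerSeries.C (algebraMap 𝒪[F] (unitBall E) π ^ N) * (hN' - relLogDeriv hπ E gN) +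
            PowerSeries.C (algebraMap 𝒪[F] (unitBall E) π ^ N - (m₁ : unitBall E) ^ N) * relLogDeriv hπ E gN := by
        have e1 : PowerSeries.C (algebraMap 𝒪[F] (unitBall E) π ^ N - (m₁ : unitBall E) ^ N) =
            PowerSeries.C (algebraMap 𝒪[F] (unitBall E) π ^ N) - ((m₁ : PowerSeries (unitBall E))) ^ N := by
          rw [map_sub (PowerSeries.C (R := unitBall E)), map_pow (PowerSeries.C (R := unitBall E)) (m₁ : unitBall E) N, map_natCast]
        rw [relLogDeriv_mul, relLogDeriv_pow, Nat.cast_pow, e1]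
        linear_combination hhN'
      rw [e]
      refine add_mem ?_ ?_
      · have := C_mul_mem_coeffIdeal_span_mul₂ (Ideal.mem_span_singleton_self (algebraMap 𝒪[F] (unitBall E) π ^ N)) hgN
        rwa [← pow_succ] at this
      · exact C_mul_mem_coeffIdeal (Ideal.mem_span_singleton.mpr hmN) _

end RelativeDense

end Literature.NumberTheory.GaloisRepresentations
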